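import Literature.MathematicalPhysics.QuantumLattice.SchwingerOSAxioms
import HarnessLib

/-!
# The mass gap on Osterwalder–Schrader data (`MassGapOS`)

Trunk **T-AQFT**, notion `MassGapOS` (D-0015; audits `audit-QuantumFields` D4,
`audit-QuantumFields-QCD` Q7). For a Schwinger family `𝔖 = (𝔖ₙ)ₙ` on `ℝ^d`
(`Literature.MathematicalPhysics.QuantumLattice.SchwingerFamily`, time = coordinate `0`) and `Δ > 0`,
`SchwingerFamily.MassGapOS 𝔖 Δ` is **exponential clustering in the time direction of all
truncated Schwinger functions at the single rate `Δ`**: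

  for all time-ordered test functions `F ∈ 𝒮_<((ℝ^d)^n)`, `G ∈ 𝒮_<((ℝ^d)^k)` there is `C` with
  `|𝔖_{n+k}(ΘF* ⊗ T_t G) − 𝔖ₙ(ΘF*) 𝔖_k(G)| ≤ C e^{−Δ t}` for all `t ≥ 0`,

where `ΘF* = osAdjoint F`, `T_t G = translateMulti (t e₀) G` is the forward time translation and
tensor products enter in witness form (`IsAppendTensorOf`), exactly as in E2/E4 of
`SchwingerOSAxioms`.

## Why this is "the mass gap" (Jaffe–Witten 2000, §4)

Jaffe–Witten: "A quantum field theory has a mass gap `Δ` if `H` has no spectrum in the interval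
`(0, Δ)` for some `Δ > 0`. The supremum of such `Δ` is the mass `m`, and we require `m < ∞`."
After Osterwalder–Schrader reconstruction (OS 1973, §4) the physical Hilbert space `𝓗` is
spanned by the classes `Ψ_G` of time-ordered test functions, with
`⟨Ψ_F, Ψ_G⟩ = 𝔖_{n+k}(ΘF* ⊗ G)`, `⟨Ω, Ψ_G⟩ = 𝔖_k(G)`, and `e^{−tH} Ψ_G = Ψ_{T_t G}` (`t ≥ 0`).
Hence the clustered quantity is `⟨Ψ_F, (e^{−tH} − |Ω⟩⟨Ω|) Ψ_G⟩`, and: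

* if `Ω` is the unique vacuum and `σ(H) ∩ (0, Δ) = ∅`, then `‖(e^{−tH} − |Ω⟩⟨Ω|)‖ ≤ e^{−Δt}`, so
  `MassGapOS 𝔖 Δ` holds with `C = ‖Ψ_F‖ ‖Ψ_G‖`;
* conversely, taking `F = G`, `⟨Ψ, (e^{−tH} − |Ω⟩⟨Ω|) Ψ⟩ = ∫ e^{−tλ} dμ_Ψ(λ) − |⟨Ω,Ψ⟩|² ≤ C e^{−Δt}`
  forces the spectral measure of every `Ψ` in the dense span of the `Ψ_G` to vanish on
  `(0, Δ)` and `ker H = ℂΩ`; by density `σ(H) ∩ (0, Δ) = ∅`.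

So, given the OS axioms, `MassGapOS 𝔖 Δ ⇔ (unique vacuum ∧ inf (σ(H) ∖ {0}) ≥ Δ)`, which is the
Jaffe–Witten mass gap (uniqueness of `Ω` being part of their §3 axioms). This is *strictly
stronger* than the tree's two-point clustering `HasExponentialClustering d μ m`
(`OSAxiomsMeasure`, only `n = k = 1`, i.e. only the spectral measures of one-field vectors
`φ(g)Ω`), which is the defect D4 of the audit; the specialisation is `MassGapOS.onePoint`.
By sesquilinearity the single-degree form used here is equivalent to the form with finite
sequences `(Fₙ)ₙ, (G_k)_k` (constants add up), so no sums over degrees are needed.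

## Junk / degenerate cases

* `S = 0` (or any family whose truncated functions vanish on time-ordered arguments, e.g. the
  vacuum-only family) satisfies `MassGapOS S Δ` for **every** `Δ > 0` (`massGapOS_zero`): this is
  Jaffe–Witten's excluded case `m = ∞`. Statements using `MassGapOS` as a *conclusion* must pair
  it with a non-degeneracy clause (audit D5: `HasNontrivialTwoPoint`), which forces `m < ∞`.
* `Δ ≤ 0` is excluded by the conjunct `0 < Δ`.
* The test-function class is `IsTimeOrdered` (`𝒮_<`, supports in `0 < x₁⁰ < ⋯ < xₙ⁰`), the class
  from which OS reconstruct `𝓗`; it avoids coincident points, so the notion is meaningful also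
  for families only controlled off the diagonals (composite fields in `d = 4`, audit D3). Asking
  it for all positive-time `F, G` (`IsPositiveTimeMulti`, the tree's E2/E4 class) is formally
  stronger and, under E0–E4, equivalent (both are equivalent to the spectral statement).

## Sources

* A. Jaffe, E. Witten, *Quantum Yang–Mills theory* (Clay Mathematics Institute, 2000), §4
  (definition of the mass gap, quoted above), §5 (clustering as a consequence).
* K. Osterwalder, R. Schrader, *Axioms for Euclidean Green's functions*, CMP 31 (1973), §3
  (E2, E4 in the `Θf* ⊗ g_{(λa,1)}` form transcribed by `HasClusterProperty`), §4
  (reconstruction: `𝓗`, `Ω`, `e^{−tH}` from `𝒮_<`).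
* J. Glimm, A. Jaffe, *Quantum Physics* (2nd ed. 1987), Ch. 19 (§19.7: from Euclidean clustering
  to the spectrum of `H`), §6.1.

## Mathlib search

No Osterwalder–Schrader / Schwinger-function / mass-gap vocabulary at the pin (searched
`Schwinger`, `massGap`, `spectralGap`, `Osterwalder`: none); everything is built on the tree's
`SchwingerFamily`, `osAdjoint`, `translateMulti`, `IsAppendTensorOf`, `IsTimeOrdered`.
-/

open scoped SchwartzMap
open MeasureTheory Filter Topology Complex

noncomputable section

namespace Literature.MathematicalPhysics.AQFT

section SchwingerFamily
open Literature.MathematicalPhysics.QuantumLattice (SchwingerFamily)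
open Literature.MathematicalPhysics.QuantumLattice.SchwingerFamily

variable {d : ℕ} [NeZero d]

/-- **Mass gap `Δ` on Osterwalder–Schrader data** (Jaffe–Witten 2000, §4: "`H` has no spectrum in
`(0, Δ)`", transported through OS reconstruction, OS 1973 §4; Glimm–Jaffe Ch. 19): `0 < Δ` and
exponential clustering in time of *all* truncated Schwinger functions at the single rate `Δ` —
for all time-ordered `F ∈ 𝒮_<((ℝ^d)^n)`, `G ∈ 𝒮_<((ℝ^d)^k)` there is a constant `C` (depending
on `F, G` only) such that for every `t ≥ 0` and every tensor-product witness
`H = ΘF* ⊗ T_t G` (`osAdjoint F ⊗ translateMulti (t e₀) G`, `IsAppendTensorOf`),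
`‖𝔖_{n+k}(H) − 𝔖ₙ(ΘF*) 𝔖_k(G)‖ ≤ C e^{−Δ t}`.
In the reconstructed theory this reads `|⟨Ψ_F, (e^{−tH} − |Ω⟩⟨Ω|) Ψ_G⟩| ≤ C e^{−Δt}` on the
total set of OS vectors, equivalent (given E0–E4) to: `Ω` is the unique vacuum and
`σ(H) ∩ (0, Δ) = ∅` (module docstring). Degenerate case: families with vanishing truncated
functions satisfy this for every `Δ` (`m = ∞`, excluded separately). [cite: JaffeWitten2000, §4] -/
def _root_.Literature.MathematicalPhysics.QuantumLattice.SchwingerFamily.MassGapOS (S : SchwingerFamily (EuclideanSpace ℝ (Fin d))) (Δ : ℝ) : Prop :=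
  0 < Δ ∧
    ∀ (n k : ℕ) (F : 𝓢((Fin n → EuclideanSpace ℝ (Fin d)), ℂ))
      (G : 𝓢((Fin k → EuclideanSpace ℝ (Fin d)), ℂ)),
      QuantumLattice.IsTimeOrdered F → QuantumLattice.IsTimeOrdered G →
        ∃ C : ℝ, ∀ t : ℝ, 0 ≤ t →
          ∀ H : 𝓢((Fin (n + k) → EuclideanSpace ℝ (Fin d)), ℂ),
            QuantumLattice.IsAppendTensorOf H (QuantumLattice.osAdjoint F) (QuantumLattice.translateMulti (EuclideanSpace.single 0 t) G) →
              ‖S (n + k) H - S n (QuantumLattice.osAdjoint F) * S k G‖ ≤ C * Real.exp (-Δ * t)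

/-- The **mass** of a Schwinger family in the sense of Jaffe–Witten 2000, §4: "the supremum of
such `Δ`". Junk values (`Real.sSup` convention): `0` if there is no gap (empty set) *and* `0` if
the set of rates is unbounded (`m = ∞`, e.g. vanishing truncated functions); consumers needing
`0 < m < ∞` should assert `MassGapOS S Δ` for an explicit `Δ` together with a non-degeneracy
clause instead. [cite: JaffeWitten2000, §4] -/
def _root_.Literature.MathematicalPhysics.QuantumLattice.SchwingerFamily.massOS (S : SchwingerFamily (EuclideanSpace ℝ (Fin d))) : ℝ :=
  sSup {Δ : ℝ | S.MassGapOS Δ}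

variable {S : SchwingerFamily (EuclideanSpace ℝ (Fin d))} {Δ Δ' : ℝ}

/-- A mass gap is positive. [folklore] -/
theorem _root_.Literature.MathematicalPhysics.QuantumLattice.SchwingerFamily.MassGapOS.pos (h : S.MassGapOS Δ) : 0 < Δ :=
  h.1

/-- The clustering bound of a mass gap, applied. [folklore] -/
theorem _root_.Literature.MathematicalPhysics.QuantumLattice.SchwingerFamily.MassGapOS.bound (h : S.MassGapOS Δ) {n k : ℕ}
    {F : 𝓢((Fin n → EuclideanSpace ℝ (Fin d)), ℂ)} {G : 𝓢((Fin k → EuclideanSpace ℝ (Fin d)), ℂ)}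
    (hF : QuantumLattice.IsTimeOrdered F) (hG : QuantumLattice.IsTimeOrdered G) :
    ∃ C : ℝ, ∀ t : ℝ, 0 ≤ t →
      ∀ H : 𝓢((Fin (n + k) → EuclideanSpace ℝ (Fin d)), ℂ),
        QuantumLattice.IsAppendTensorOf H (QuantumLattice.osAdjoint F) (QuantumLattice.translateMulti (EuclideanSpace.single 0 t) G) →
          ‖S (n + k) H - S n (QuantumLattice.osAdjoint F) * S k G‖ ≤ C * Real.exp (-Δ * t) :=
  h.2 n k F G hF hG

/-- The constant in `MassGapOS` may be taken nonnegative. [folklore] -/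
theorem _root_.Literature.MathematicalPhysics.QuantumLattice.SchwingerFamily.MassGapOS.bound_nonneg (h : S.MassGapOS Δ) {n k : ℕ}
    {F : 𝓢((Fin n → EuclideanSpace ℝ (Fin d)), ℂ)} {G : 𝓢((Fin k → EuclideanSpace ℝ (Fin d)), ℂ)}
    (hF : QuantumLattice.IsTimeOrdered F) (hG : QuantumLattice.IsTimeOrdered G) :
    ∃ C : ℝ, 0 ≤ C ∧ ∀ t : ℝ, 0 ≤ t →
      ∀ H : 𝓢((Fin (n + k) → EuclideanSpace ℝ (Fin d)), ℂ),
        QuantumLattice.IsAppendTensorOf H (QuantumLattice.osAdjoint F) (QuantumLattice.translateMulti (EuclideanSpace.single 0 t) G) →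
          ‖S (n + k) H - S n (QuantumLattice.osAdjoint F) * S k G‖ ≤ C * Real.exp (-Δ * t) := by
  obtain ⟨C, hC⟩ := h.bound hF hG
  refine ⟨max C 0, le_max_right _ _, fun t ht H hH => (hC t ht H hH).trans ?_⟩
  exact mul_le_mul_of_nonneg_right (le_max_left _ _) (Real.exp_pos _).le

/-- **Monotonicity in the rate** ("no spectrum in `(0, Δ)`" implies "no spectrum in `(0, Δ')`" for
`0 < Δ' ≤ Δ`; Jaffe–Witten 2000, §4, whence "the supremum of such `Δ`"): a mass gap `Δ` is a
mass gap `Δ'` for every `0 < Δ' ≤ Δ`. [cite: JaffeWitten2000, §4] -/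
theorem _root_.Literature.MathematicalPhysics.QuantumLattice.SchwingerFamily.MassGapOS.anti (h : S.MassGapOS Δ) (hΔ' : 0 < Δ') (hle : Δ' ≤ Δ) : S.MassGapOS Δ' := by
  refine ⟨hΔ', fun n k F G hF hG => ?_⟩
  obtain ⟨C, hC0, hC⟩ := h.bound_nonneg hF hG
  refine ⟨C, fun t ht H hH => (hC t ht H hH).trans ?_⟩
  exact mul_le_mul_of_nonneg_left (Real.exp_le_exp.2 (by nlinarith)) hC0

/-- **From the positive-time class.** If the truncated Schwinger functions cluster at rate `Δ`
for all *positive-time* `F, G` (`IsPositiveTimeMulti`, the tree's E2/E4 test-function class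
`𝒮₊`, appropriate for families defined on all of `𝒮`), then `MassGapOS S Δ` (time-ordered
functions are positive-time). [folklore] -/
theorem _root_.Literature.MathematicalPhysics.QuantumLattice.SchwingerFamily.massGapOS_of_positiveTime (hΔ : 0 < Δ)
    (h : ∀ (n k : ℕ) (F : 𝓢((Fin n → EuclideanSpace ℝ (Fin d)), ℂ))
      (G : 𝓢((Fin k → EuclideanSpace ℝ (Fin d)), ℂ)),
      QuantumLattice.IsPositiveTimeMulti F → QuantumLattice.IsPositiveTimeMulti G →
        ∃ C : ℝ, ∀ t : ℝ, 0 ≤ t →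
          ∀ H : 𝓢((Fin (n + k) → EuclideanSpace ℝ (Fin d)), ℂ),
            QuantumLattice.IsAppendTensorOf H (QuantumLattice.osAdjoint F) (QuantumLattice.translateMulti (EuclideanSpace.single 0 t) G) →
              ‖S (n + k) H - S n (QuantumLattice.osAdjoint F) * S k G‖ ≤ C * Real.exp (-Δ * t)) :
    S.MassGapOS Δ :=
  ⟨hΔ, fun n k F G hF hG => h n k F G hF.isPositiveTimeMulti hG.isPositiveTimeMulti⟩

/-- The set of mass gaps of a family is an initial segment of `(0, ∞)`: it contains `(0, Δ]` as
soon as it contains `Δ`. [folklore] -/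
theorem _root_.Literature.MathematicalPhysics.QuantumLattice.SchwingerFamily.MassGapOS.Ioc_subset (h : S.MassGapOS Δ) : Set.Ioc 0 Δ ⊆ {Δ' | S.MassGapOS Δ'} :=
  fun _ hx => h.anti hx.1 hx.2

/-- A mass gap is at most the mass, provided the set of gaps is bounded (i.e. `m < ∞`, the
Jaffe–Witten requirement); without boundedness `massOS` is the junk value `0`. [cite: JaffeWitten2000, §4] -/
theorem _root_.Literature.MathematicalPhysics.QuantumLattice.SchwingerFamily.MassGapOS.le_massOS (h : S.MassGapOS Δ) (hb : BddAbove {Δ' | S.MassGapOS Δ'}) :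
    Δ ≤ S.massOS :=
  le_csSup hb h

/-- **The two-point specialisation** (`n = k = 1`): a mass gap `Δ` on OS data gives exponential
clustering at rate `Δ` of the truncated two-point Schwinger function at time-separated
one-point test functions, `‖𝔖₂(Θf* ⊗ T_t g) − 𝔖₁(Θf*) 𝔖₁(g)‖ ≤ C e^{−Δt}` — the (strictly weaker)
form recorded by `HasExponentialClustering` in `OSAxiomsMeasure` (audit D4). For one-point
functions "time-ordered" is just "positive-time". [folklore] -/
theorem _root_.Literature.MathematicalPhysics.QuantumLattice.SchwingerFamily.MassGapOS.onePoint (h : S.MassGapOS Δ)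
    {f g : 𝓢((Fin 1 → EuclideanSpace ℝ (Fin d)), ℂ)} (hf : QuantumLattice.IsTimeOrdered f) (hg : QuantumLattice.IsTimeOrdered g) :
    ∃ C : ℝ, ∀ t : ℝ, 0 ≤ t →
      ∀ H : 𝓢((Fin (1 + 1) → EuclideanSpace ℝ (Fin d)), ℂ),
        QuantumLattice.IsAppendTensorOf H (QuantumLattice.osAdjoint f) (QuantumLattice.translateMulti (EuclideanSpace.single 0 t) g) →
          ‖S (1 + 1) H - S 1 (QuantumLattice.osAdjoint f) * S 1 g‖ ≤ C * Real.exp (-Δ * t) :=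
  h.bound hf hg

/-- For one-point test functions, time-ordered ⟺ positive-time (the ordering condition on a
single time is vacuous). [folklore] -/
theorem _root_.Literature.MathematicalPhysics.QuantumLattice.SchwingerFamily.isTimeOrdered_iff_isPositiveTimeMulti_one
    (F : 𝓢((Fin 1 → EuclideanSpace ℝ (Fin d)), ℂ)) :
    QuantumLattice.IsTimeOrdered F ↔ QuantumLattice.IsPositiveTimeMulti F := by
  refine ⟨QuantumLattice.IsTimeOrdered.isPositiveTimeMulti, fun h x hx => ⟨h hx, ?_⟩⟩
  intro i j hij
  exact absurd hij (by simp [Subsingleton.elim i j])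

/-- **Degenerate inhabitant** (`m = ∞`): the zero family clusters at every rate `Δ > 0`
(all its truncated functions vanish). Recorded to make the junk case explicit; problem
statements pair `MassGapOS` with a non-degeneracy clause. [folklore] -/
theorem _root_.Literature.MathematicalPhysics.QuantumLattice.SchwingerFamily.massGapOS_zero (hΔ : 0 < Δ) :
    (0 : SchwingerFamily (EuclideanSpace ℝ (Fin d))).MassGapOS Δ :=
  ⟨hΔ, fun n k F G _ _ => ⟨0, fun t _ H _ => by simp⟩⟩

/-- Consequently the zero family has every positive real as a gap, its gap set is unbounded, and
`massOS 0` is the junk value `0` (`Real.sSup` of an unbounded set). [folklore] -/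
theorem _root_.Literature.MathematicalPhysics.QuantumLattice.SchwingerFamily.massOS_zero : (0 : SchwingerFamily (EuclideanSpace ℝ (Fin d))).massOS = 0 := by
  have hset : {Δ' : ℝ | (0 : SchwingerFamily (EuclideanSpace ℝ (Fin d))).MassGapOS Δ'} =
      Set.Ioi 0 := by
    ext x
    exact ⟨fun h => h.pos, fun h => massGapOS_zero h⟩
  have hnb : ¬ BddAbove (Set.Ioi (0 : ℝ)) := not_bddAbove_Ioi 0
  rw [massOS, hset, Real.sSup_of_not_bddAbove hnb]

end SchwingerFamily

end Literature.MathematicalPhysics.AQFT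

end
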